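/-
Copyright: the b2b-balaban T⁴-continuum CRUX team, row NE7b leaf lineage `t4-ne7b-formalise-leaf-03` (gen 143). Project licence.
-/
import Literature.Analysis.Calculus.TaylorSegment
import Mathlib.Analysis.Calculus.Gradient.Basic
import Mathlib.Analysis.Calculus.Deriv.MeanValue
import Mathlib.Analysis.Calculus.ContDiff.Operations

/-!
# THE HESSIAN ENTRY IN FORM CURRENCY: `D²Φ(x)[v, v] ≥ 2·Q(v)` ON a convex window gives the first-order letter WITH THE FORM `Q`,
# `Φ x + DΦ(x)(y − x) + Q(y − x) ≤ Φ y` on the window — the upstream supplier of `…ConvexityModulusTransport` §3 ∕ `…ConvexityModulusSchur`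
# for a COUPLED (block, seminorm, Schur) modulus form; `…ConvexWindowSuppliers.firstOrderOn_of_hessianOn_lower` is the scalar case
# `Q = (κ∕2)‖·‖²` (row NE7b, node U5c; residual (R2′) family (2), letter (ℓ1) in FORM currency; kernel lemma of calculus)

Cell `pub-balaban`, sub-cell `t4`, spine estimate NE7b (`T4WeightBudget.RelWeightBound`; the cell's OWN estimate — NOT PRINTED in
[Bałaban 1983–89], NOT PROVED).  Crux-route work under `Spine/NE7b/` by a row leaf on the convexity road; NOTHING of Bałaban's is named
or asserted; no `T4Continuum/Support` leaf typed; no `def`; zero `sorry`.  Imports: the tree's `Literature.Analysis.Calculus.TaylorSegment`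
(segment derivatives, built) and Mathlib only — independent of the farm's olean frontier.

WHY.  The road's modulus letter (ℓ1) now travels in FORM currency — `V x + ⟪dV x, y − x⟫ + Q(y − x) ≤ V y` with a 2-homogeneous `Q`
(`…ConvexityModulusTransport` §3 turns it into the secant letter with `Q`, §4 transports it exactly through linear charts,
`…LogConcaveMarginal` §6 passes a base form through the fluctuation integral, `…ConvexityModulusSchur` takes the Schur step from a
coupled joint form) — because the scalar full-norm modulus is volume-degenerate across steps while a seminorm ∕ Schur form is
self-sustaining (refuter κ-ne7bref-g77-1).  But the only typed ENTRY from a Hessian bound into the letter is SCALAR: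
`…ConvexWindowSuppliers.firstOrderOn_of_hessianOn_lower` reads `κ‖v‖² ≤ D²Φ(x)[v, v]` ON `K` into the letter with `(κ∕2)‖y − x‖²`.  An
instance that displays a BLOCK (coupled) Hessian lower bound `D²Φ(x)[v, v] ≥ 2·Q(v)` — the shape the refuter's desk currency names
(HANDOFF § refuter gen 78: the marginal's form is the Schur complement of the block Hessian) — needs the same Taylor-on-the-segment
argument with `Q(ξ)` in place of `(κ∕2)‖ξ‖²`.  THIS FILE types it, for ANY functional `Q` (only its value at the chord `ξ = y − x`
enters; no homogeneity, sign or continuity asked), on ANY real normed space in `fderiv` currency and on complete inner product spaces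
in `gradient` currency.

WHAT IS PROVED ([folklore] calculus; the tree's segment-derivative lemmas `hasDerivAt_comp_lineSegment` ∕ `hasDerivAt_fderiv_comp_lineSegment`
and Mathlib's `monotoneOn_of_deriv_nonneg`, `inner_gradient_left` BY NAME):
* §1 **`firstOrderOn_form_of_hessianOn_lower_fderiv`** — `K` convex, `Φ ∈ C²`, `∀ x ∈ K, ∀ v, 2·Q(v) ≤ D²Φ(x)[v, v]` ⟹
  `∀ x y ∈ K, Φ x + DΦ(x)(y − x) + Q(y − x) ≤ Φ y` (real normed space `E`).
* §2 **`firstOrderOn_form_of_hessianOn_lower`** — the same in gradient currency `Φ x + ⟪∇Φ x, y − x⟫ + Q(y − x) ≤ Φ y` (complete real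
  inner product space) — verbatim the hypothesis `h` of `…ConvexityModulusTransport.secant_of_firstOrderOn_form` with `dV := gradient Φ`.
* §3 `firstOrderOn_form_of_hessianOn_lower_chord` — the hypothesis weakened to CHORD directions: `2·Q(y − x) ≤ D²Φ(z)[y − x, y − x]`
  for `x, y ∈ K` and `z` on the segment `[x, y]` suffices (what a window-restricted reading actually checks).
* §4 (v2, appended; chair leaf-05 g148's ι-X-HFFO-g148-1) the PRODUCT entry WITHOUT a carrier chart: on `E₁ × E₂` (complete inner product
  factors; the product's own sup norm carries `C²` and `D²Φ`) §1's `fderiv` letter splits by Riesz into the TWO PARTIAL FIELDS of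
  `…ConvexityModulusSchur` §2 — `fderiv_prod_apply_eq_inner_add` and **`firstOrderOn_form_of_hessianOn_lower_prod`**:
  `Φ p + ⟪d₁Φ p, q₁ − p₁⟫ + ⟪d₂Φ p, q₂ − p₂⟫ + Q(q − p) ≤ Φ q` on `K`, `dᵢΦ p = (toDual ℝ Eᵢ)⁻¹(DΦ(p) ∘ inᵢ)` — verbatim the `h` of
  `…ConvexityModulusSchur.secant_of_firstOrderOn_prod_jointForm` ∕ `secantForm_schur_of_firstOrderOn_jointBlockForm`.
* §5 (v3, appended; refuter ι-ne7bref-g80-1) the WINDOW-SMOOTH exponent: `U` open, `K ⊆ U` convex, `Φ ∈ C²(U)` only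
  (`ContDiffOn ℝ 2 Φ U`) — `hasDerivAt_comp_lineSegment_of_contDiffOn` ∕ `hasDerivAt_fderiv_comp_lineSegment_of_contDiffOn` (pointwise
  segment derivatives), `apply_add_fderiv_add_le_of_segment_of_contDiffOn` (engine), **`firstOrderOn_form_of_hessianOn_lower_fderiv_of_contDiffOn`**,
  `firstOrderOn_form_of_hessianWithin_lower_fderiv` (display in `iteratedFDerivWithin ℝ 2 Φ U` currency, = the same on open `U`),
  `firstOrderOn_form_of_hessianOn_lower_of_contDiffOn` (gradient currency).

NOT HERE (honest): which block form and which chart Bałaban's exponents display — (A3) ∕ (A1c), NC-NE7b-α UNRULED; the scalar case (in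
the tree, not restated); anything of Bałaban's.  BY-NAME EFFECT ON THE WALL: NONE.  NE7b NOT PRINTED ∕ NOT PROVED; spine PROVED 0∕9;
rung (B)+1 on a FINITE torus — NOT infinite volume, NOT the mass gap, NOT Clay.
HONEST DEPENDENCY: continuum YM on T⁴ ⇐ BetaPertH ∧ nine spine estimates (0/9 proved); BetaPertH ⇐ (D1) ∧ (D4) ∧ CAP+tail.
-/

set_option autoImplicit false

open Set
open scoped RealInnerProductSpace Gradient

namespace Summit.QuantumFields.BalabanUV.T4Continuum.NE7b.HessianFormFirstOrder

/-! ## §3 first (the engine): the chord-direction hypothesis along one segment -/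

section Normed

variable {E : Type*} [NormedAddCommGroup E] [NormedSpace ℝ E]

/-- **TAYLOR ON THE SEGMENT WITH A FORM**: for `Φ ∈ C²` and two points `x, y` such that along the segment
`D²Φ(x + θ(y − x))[y − x, y − x] ≥ 2·q` for `θ ∈ [0, 1]`, one has `Φ x + DΦ(x)(y − x) + q ≤ Φ y` (`q` any real number — the value of the
modulus form at the chord). [folklore] -/
theorem apply_add_fderiv_add_le_of_segment {Φ : E → ℝ} (hΦ : ContDiff ℝ 2 Φ) (x y : E) {q : ℝ}
    (hH : ∀ θ ∈ Icc (0 : ℝ) 1, 2 * q ≤ iteratedFDeriv ℝ 2 Φ (x + θ • (y - x)) ![y - x, y - x]) :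
    Φ x + fderiv ℝ Φ x (y - x) + q ≤ Φ y := by
  set ξ : E := y - x with hξ
  have hΦd : Differentiable ℝ Φ := hΦ.differentiable (by norm_num)
  -- the restriction to the segment and its first two derivatives
  set g : ℝ → ℝ := fun θ => Φ (x + θ • ξ) with hg
  set g' : ℝ → ℝ := fun θ => fderiv ℝ Φ (x + θ • ξ) ξ with hg'
  set g'' : ℝ → ℝ := fun θ => fderiv ℝ (fderiv ℝ Φ) (x + θ • ξ) ξ ξ with hg''
  have hg1 : ∀ θ, HasDerivAt g (g' θ) θ := fun θ =>
    Literature.Analysis.Calculus.hasDerivAt_comp_lineSegment hΦd x ξ θ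
  have hg2 : ∀ θ, HasDerivAt g' (g'' θ) θ := fun θ =>
    Literature.Analysis.Calculus.hasDerivAt_fderiv_comp_lineSegment hΦ x ξ θ
  have hg2low : ∀ θ ∈ Icc (0 : ℝ) 1, 2 * q ≤ g'' θ := fun θ hθ => by
    have := hH θ hθ
    rwa [iteratedFDeriv_two_apply] at this
  -- the auxiliary function `φ` and its derivative `φ'`
  set φ : ℝ → ℝ := fun θ => g θ - g 0 - θ * g' 0 - θ ^ 2 * q with hφ
  set φ' : ℝ → ℝ := fun θ => g' θ - g' 0 - 2 * θ * q with hφ'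
  have hφd : ∀ θ, HasDerivAt φ (φ' θ) θ := fun θ => by
    have h2 : HasDerivAt (fun θ' : ℝ => θ' * g' 0) (g' 0) θ := by
      simpa using (hasDerivAt_id θ).mul_const (g' 0)
    have h3 : HasDerivAt (fun θ' : ℝ => θ' ^ 2 * q) (2 * θ * q) θ := by
      have := (hasDerivAt_pow 2 θ).mul_const q
      refine this.congr_deriv ?_
      simp only [Nat.cast_ofNat, Nat.add_one_sub_one, pow_one]
    exact ((((hg1 θ).sub_const (g 0)).sub h2).sub h3).congr_deriv (by simp [hφ'])
  have hφ'd : ∀ θ, HasDerivAt φ' (g'' θ - 2 * q) θ := fun θ => by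
    have h3 : HasDerivAt (fun θ' : ℝ => 2 * θ' * q) (2 * q) θ := by
      simpa using ((hasDerivAt_id θ).const_mul (2 : ℝ)).mul_const q
    exact ((hg2 θ).sub_const (g' 0)).sub h3
  -- `φ'` is monotone ON `[0,1]` with `φ' 0 = 0`, so `φ' ≥ 0` there; hence `φ` is monotone ON `[0,1]`
  have hφ'mono : MonotoneOn φ' (Icc 0 1) := by
    refine monotoneOn_of_deriv_nonneg (convex_Icc 0 1)
      (fun θ _ => (hφ'd θ).continuousAt.continuousWithinAt)
      (fun θ _ => (hφ'd θ).differentiableAt.differentiableWithinAt) fun θ hθ => ?_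
    rw [interior_Icc] at hθ
    rw [(hφ'd θ).deriv]
    linarith [hg2low θ ⟨hθ.1.le, hθ.2.le⟩]
  have hφ'nonneg : ∀ θ ∈ Icc (0 : ℝ) 1, 0 ≤ φ' θ := fun θ hθ => by
    have h0 : φ' 0 = 0 := by simp [hφ']
    rw [← h0]
    exact hφ'mono (left_mem_Icc.2 zero_le_one) hθ hθ.1
  have hφmono : MonotoneOn φ (Icc 0 1) := by
    refine monotoneOn_of_deriv_nonneg (convex_Icc 0 1)
      (fun θ _ => (hφd θ).continuousAt.continuousWithinAt)
      (fun θ _ => (hφd θ).differentiableAt.differentiableWithinAt) fun θ hθ => ?_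
    rw [interior_Icc] at hθ
    rw [(hφd θ).deriv]
    exact hφ'nonneg θ ⟨hθ.1.le, hθ.2.le⟩
  have hφ1 : 0 ≤ φ 1 := by
    have h0 : φ 0 = 0 := by simp [hφ]
    rw [← h0]
    exact hφmono (left_mem_Icc.2 zero_le_one) (right_mem_Icc.2 zero_le_one) zero_le_one
  -- unfold at `θ = 1`
  simp only [hφ, hg, hg', one_smul, zero_smul, add_zero, one_mul, one_pow] at hφ1
  have hy' : x + ξ = y := by rw [hξ]; abel
  rw [hy'] at hφ1
  linarith

/-- **CHORD-DIRECTION HYPOTHESIS ON A CONVEX WINDOW** (`fderiv` currency): `K` convex, `Φ ∈ C²`, and for all `x, y ∈ K` and every `z`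
on the segment `[x, y]`, `2·Q(y − x) ≤ D²Φ(z)[y − x, y − x]` ⟹ `Φ x + DΦ(x)(y − x) + Q(y − x) ≤ Φ y` on `K`. [folklore] -/
theorem firstOrderOn_form_of_hessianOn_lower_chord {Φ : E → ℝ} {K : Set E} (hΦ : ContDiff ℝ 2 Φ) (Q : E → ℝ)
    (hH : ∀ x ∈ K, ∀ y ∈ K, ∀ θ ∈ Icc (0 : ℝ) 1, 2 * Q (y - x) ≤ iteratedFDeriv ℝ 2 Φ (x + θ • (y - x)) ![y - x, y - x]) :
    ∀ x ∈ K, ∀ y ∈ K, Φ x + fderiv ℝ Φ x (y - x) + Q (y - x) ≤ Φ y :=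
  fun x hx y hy => apply_add_fderiv_add_le_of_segment hΦ x y (hH x hx y hy)

/-! ## §1 The Hessian entry ON a convex window, `fderiv` currency -/

/-- **HESSIAN LOWER BOUND BY A FORM ⟹ FIRST-ORDER LETTER WITH THE FORM** (`fderiv` currency, any real normed space): `K` convex,
`Φ ∈ C²`, `∀ x ∈ K, ∀ v, 2·Q(v) ≤ D²Φ(x)[v, v]` ⟹ `∀ x y ∈ K, Φ x + DΦ(x)(y − x) + Q(y − x) ≤ Φ y`.  `Q` is ANY functional (a block ∕
seminorm ∕ Schur quadratic form in applications; only `Q(y − x)` enters).  The scalar case `Q = (κ∕2)‖·‖²` is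
`…ConvexWindowSuppliers.firstOrderOn_of_hessianOn_lower` (in the tree). [folklore] -/
theorem firstOrderOn_form_of_hessianOn_lower_fderiv {Φ : E → ℝ} {K : Set E} (hK : Convex ℝ K) (hΦ : ContDiff ℝ 2 Φ) (Q : E → ℝ)
    (hH : ∀ x ∈ K, ∀ v : E, 2 * Q v ≤ iteratedFDeriv ℝ 2 Φ x ![v, v]) :
    ∀ x ∈ K, ∀ y ∈ K, Φ x + fderiv ℝ Φ x (y - x) + Q (y - x) ≤ Φ y := by
  refine firstOrderOn_form_of_hessianOn_lower_chord hΦ Q fun x hx y hy θ hθ => hH _ ?_ _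
  exact hK.add_smul_mem hx (by rw [add_sub_cancel]; exact hy) hθ

end Normed

/-! ## §2 The Hessian entry ON a convex window, gradient currency (the road's letter shape) -/

section Inner

variable {E : Type*} [NormedAddCommGroup E] [InnerProductSpace ℝ E] [CompleteSpace E]

/-- **HESSIAN LOWER BOUND BY A FORM ⟹ THE ROAD'S FIRST-ORDER LETTER WITH THE FORM** (gradient currency): `K` convex, `Φ ∈ C²`,
`∀ x ∈ K, ∀ v, 2·Q(v) ≤ D²Φ(x)[v, v]` ⟹ `∀ x y ∈ K, Φ x + ⟪∇Φ x, y − x⟫ + Q(y − x) ≤ Φ y` — verbatim the hypothesis of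
`…ConvexityModulusTransport.secant_of_firstOrderOn_form` with `dV := gradient Φ` (then `Q` 2-homogeneous gives the secant letter with `Q`,
and `…ConvexityModulusSchur` the Schur step). [folklore] -/
theorem firstOrderOn_form_of_hessianOn_lower {Φ : E → ℝ} {K : Set E} (hK : Convex ℝ K) (hΦ : ContDiff ℝ 2 Φ) (Q : E → ℝ)
    (hH : ∀ x ∈ K, ∀ v : E, 2 * Q v ≤ iteratedFDeriv ℝ 2 Φ x ![v, v]) :
    ∀ x ∈ K, ∀ y ∈ K, Φ x + ⟪gradient Φ x, y - x⟫ + Q (y - x) ≤ Φ y := by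
  intro x hx y hy
  rw [inner_gradient_left]
  exact firstOrderOn_form_of_hessianOn_lower_fderiv hK hΦ Q hH x hx y hy

/-- The same from the CHORD-direction hypothesis only (gradient currency). [folklore] -/
theorem firstOrderOn_form_of_hessianOn_lower_chord_gradient {Φ : E → ℝ} {K : Set E} (hΦ : ContDiff ℝ 2 Φ) (Q : E → ℝ)
    (hH : ∀ x ∈ K, ∀ y ∈ K, ∀ θ ∈ Icc (0 : ℝ) 1, 2 * Q (y - x) ≤ iteratedFDeriv ℝ 2 Φ (x + θ • (y - x)) ![y - x, y - x]) :
    ∀ x ∈ K, ∀ y ∈ K, Φ x + ⟪gradient Φ x, y - x⟫ + Q (y - x) ≤ Φ y := by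
  intro x hx y hy
  rw [inner_gradient_left]
  exact firstOrderOn_form_of_hessianOn_lower_chord hΦ Q hH x hx y hy

/-- **TWO-SIDED READING** (what a block display gives at once): `2·Q(v) ≤ D²Φ(x)[v, v] ≤ 2·R(v)` ON `K` ⟹ the modulus letter with `Q`
AND the growth letter with `R`: `Φ x + ⟪∇Φ x, y − x⟫ + Q(y − x) ≤ Φ y ≤ Φ x + ⟪∇Φ x, y − x⟫ + R(y − x)` on `K` (the upper half is the
lower half for `−Φ` and `−R`). [folklore] -/
theorem firstOrderOn_form_twoSided_of_hessianOn {Φ : E → ℝ} {K : Set E} (hK : Convex ℝ K) (hΦ : ContDiff ℝ 2 Φ) (Q R : E → ℝ)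
    (hlo : ∀ x ∈ K, ∀ v : E, 2 * Q v ≤ iteratedFDeriv ℝ 2 Φ x ![v, v])
    (hup : ∀ x ∈ K, ∀ v : E, iteratedFDeriv ℝ 2 Φ x ![v, v] ≤ 2 * R v) :
    ∀ x ∈ K, ∀ y ∈ K, Φ x + ⟪gradient Φ x, y - x⟫ + Q (y - x) ≤ Φ y ∧ Φ y ≤ Φ x + ⟪gradient Φ x, y - x⟫ + R (y - x) := by
  intro x hx y hy
  refine ⟨firstOrderOn_form_of_hessianOn_lower hK hΦ Q hlo x hx y hy, ?_⟩
  -- the upper half: apply the `fderiv` lemma to `−Φ` with the form `−R`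
  have hΦn : ContDiff ℝ 2 (-Φ) := hΦ.neg
  have hHn : ∀ z ∈ K, ∀ v : E, 2 * (-R v) ≤ iteratedFDeriv ℝ 2 (-Φ) z ![v, v] := by
    intro z hz v
    rw [iteratedFDeriv_neg_apply, neg_apply]
    linarith [hup z hz v]
  have key := firstOrderOn_form_of_hessianOn_lower_fderiv hK hΦn (fun v => -R v) hHn x hx y hy
  rw [Pi.neg_apply, Pi.neg_apply, fderiv_neg, neg_apply] at key
  rw [inner_gradient_left]
  linarith

end Inner

/-! ## §4 (v2, appended): the PRODUCT entry without a carrier chart — Riesz-split of the `fderiv` letter on `E₁ × E₂` into the two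
partial fields of `…ConvexityModulusSchur` §2 (chair leaf-05 g148's ι-X-HFFO-g148-1: the product's sup norm is not an inner product, so §2's
gradient currency does not apply on `E₁ × E₂`; §1's `fderiv` currency does, and each partial derivative has a Riesz vector in its factor) -/

section ProdEntry

variable {E₁ E₂ : Type*} [NormedAddCommGroup E₁] [InnerProductSpace ℝ E₁] [CompleteSpace E₁]
  [NormedAddCommGroup E₂] [InnerProductSpace ℝ E₂] [CompleteSpace E₂]

/-- **RIESZ SPLIT OF THE DERIVATIVE ON A PRODUCT**: `DΦ(p)h = ⟪d₁Φ p, h₁⟫ + ⟪d₂Φ p, h₂⟫` with the partial Riesz vectors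
`d₁Φ p = (toDual ℝ E₁)⁻¹(DΦ(p) ∘ inl)`, `d₂Φ p = (toDual ℝ E₂)⁻¹(DΦ(p) ∘ inr)`. [folklore] -/
theorem fderiv_prod_apply_eq_inner_add (Φ : E₁ × E₂ → ℝ) (p h : E₁ × E₂) :
    fderiv ℝ Φ p h =
      ⟪(InnerProductSpace.toDual ℝ E₁).symm ((fderiv ℝ Φ p).comp (ContinuousLinearMap.inl ℝ E₁ E₂)), h.1⟫ +
        ⟪(InnerProductSpace.toDual ℝ E₂).symm ((fderiv ℝ Φ p).comp (ContinuousLinearMap.inr ℝ E₁ E₂)), h.2⟫ := by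
  rw [InnerProductSpace.toDual_symm_apply, InnerProductSpace.toDual_symm_apply, ContinuousLinearMap.comp_apply,
    ContinuousLinearMap.comp_apply, ContinuousLinearMap.inl_apply, ContinuousLinearMap.inr_apply, ← map_add, Prod.mk_add_mk, add_zero,
    zero_add]

/-- **HESSIAN LOWER BOUND BY A FORM ON A PRODUCT ⟹ THE JOINT FIRST-ORDER LETTER WITH TWO PARTIAL FIELDS** (no carrier chart): `K ⊆ E₁ × E₂`
convex, `Φ ∈ C²` on the product, `∀ p ∈ K, ∀ v, 2·Q(v) ≤ D²Φ(p)[v, v]` ⟹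
`Φ p + ⟪d₁Φ p, q₁ − p₁⟫ + ⟪d₂Φ p, q₂ − p₂⟫ + Q(q − p) ≤ Φ q` on `K` — verbatim the hypothesis `h` of
`…ConvexityModulusSchur.secant_of_firstOrderOn_prod_jointForm` (with `dVᵢ := dᵢΦ`), hence of its Schur END. [folklore] -/
theorem firstOrderOn_form_of_hessianOn_lower_prod {Φ : E₁ × E₂ → ℝ} {K : Set (E₁ × E₂)} (hK : Convex ℝ K) (hΦ : ContDiff ℝ 2 Φ)
    (Q : E₁ × E₂ → ℝ) (hH : ∀ p ∈ K, ∀ v : E₁ × E₂, 2 * Q v ≤ iteratedFDeriv ℝ 2 Φ p ![v, v]) :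
    ∀ p ∈ K, ∀ q ∈ K,
      Φ p + ⟪(InnerProductSpace.toDual ℝ E₁).symm ((fderiv ℝ Φ p).comp (ContinuousLinearMap.inl ℝ E₁ E₂)), q.1 - p.1⟫ +
          ⟪(InnerProductSpace.toDual ℝ E₂).symm ((fderiv ℝ Φ p).comp (ContinuousLinearMap.inr ℝ E₁ E₂)), q.2 - p.2⟫ +
        Q (q - p) ≤ Φ q := by
  intro p hp q hq
  have key := firstOrderOn_form_of_hessianOn_lower_fderiv hK hΦ Q hH p hp q hq
  rw [fderiv_prod_apply_eq_inner_add Φ p (q - p), Prod.fst_sub, Prod.snd_sub] at key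
  linarith

end ProdEntry

/-! ## §5 (v3, appended): the exponent only `C²` ON AN OPEN SET containing the window (refuter ι-ne7bref-g80-1: the tree's scalar
entry and §1–§4 ask global `ContDiff ℝ 2 Φ`; print's exponents live on their analyticity domains) — pointwise segment derivatives from
`ContDiffOn ℝ 2 Φ U`, the same monotone-from-zero argument run ON `[0, 1]` only -/

section Within

variable {E : Type*} [NormedAddCommGroup E] [NormedSpace ℝ E]

/-- Along a segment inside an open set where `Φ` is `C²`: `σ ↦ Φ(x + σξ)` has derivative `DΦ(x + θξ)ξ` at `θ`. [folklore] -/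
theorem hasDerivAt_comp_lineSegment_of_contDiffOn {Φ : E → ℝ} {U : Set E} (hU : IsOpen U) (hΦ : ContDiffOn ℝ 2 Φ U) (x ξ : E)
    {θ : ℝ} (hθ : x + θ • ξ ∈ U) :
    HasDerivAt (fun σ : ℝ => Φ (x + σ • ξ)) (fderiv ℝ Φ (x + θ • ξ) ξ) θ := by
  have hd : DifferentiableAt ℝ Φ (x + θ • ξ) :=
    ((hΦ.contDiffAt (hU.mem_nhds hθ)).differentiableAt (by norm_num))
  exact hd.hasFDerivAt.comp_hasDerivAt θ (Literature.Analysis.Calculus.hasDerivAt_lineSegment x ξ θ)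

/-- Along a segment inside an open set where `Φ` is `C²`: `σ ↦ DΦ(x + σξ)ξ` has derivative `D²Φ(x + θξ)[ξ, ξ]` at `θ`. [folklore] -/
theorem hasDerivAt_fderiv_comp_lineSegment_of_contDiffOn {Φ : E → ℝ} {U : Set E} (hU : IsOpen U) (hΦ : ContDiffOn ℝ 2 Φ U)
    (x ξ : E) {θ : ℝ} (hθ : x + θ • ξ ∈ U) :
    HasDerivAt (fun σ : ℝ => fderiv ℝ Φ (x + σ • ξ) ξ) (fderiv ℝ (fderiv ℝ Φ) (x + θ • ξ) ξ ξ) θ := by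
  have hc : ContDiffAt ℝ 2 Φ (x + θ • ξ) := hΦ.contDiffAt (hU.mem_nhds hθ)
  have hd : DifferentiableAt ℝ (fderiv ℝ Φ) (x + θ • ξ) :=
    (hc.fderiv_right (m := 1) (by norm_num)).differentiableAt (by norm_num)
  have h1 : HasDerivAt (fun σ : ℝ => fderiv ℝ Φ (x + σ • ξ)) (fderiv ℝ (fderiv ℝ Φ) (x + θ • ξ) ξ) θ :=
    hd.hasFDerivAt.comp_hasDerivAt θ (Literature.Analysis.Calculus.hasDerivAt_lineSegment x ξ θ)
  exact h1.clm_apply (hasDerivAt_const θ ξ) |>.congr_deriv (by simp)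

/-- **TAYLOR ON THE SEGMENT WITH A FORM, `C²` ONLY NEAR THE SEGMENT**: `U` open, `Φ ∈ C²(U)`, the segment `[x, y] ⊆ U`, and
`D²Φ(x + θ(y − x))[y − x, y − x] ≥ 2·q` for `θ ∈ [0, 1]` ⟹ `Φ x + DΦ(x)(y − x) + q ≤ Φ y`. [folklore] -/
theorem apply_add_fderiv_add_le_of_segment_of_contDiffOn {Φ : E → ℝ} {U : Set E} (hU : IsOpen U) (hΦ : ContDiffOn ℝ 2 Φ U)
    (x y : E) (hseg : ∀ θ ∈ Icc (0 : ℝ) 1, x + θ • (y - x) ∈ U) {q : ℝ}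
    (hH : ∀ θ ∈ Icc (0 : ℝ) 1, 2 * q ≤ iteratedFDeriv ℝ 2 Φ (x + θ • (y - x)) ![y - x, y - x]) :
    Φ x + fderiv ℝ Φ x (y - x) + q ≤ Φ y := by
  set ξ : E := y - x with hξ
  set g : ℝ → ℝ := fun θ => Φ (x + θ • ξ) with hg
  set g' : ℝ → ℝ := fun θ => fderiv ℝ Φ (x + θ • ξ) ξ with hg'
  set g'' : ℝ → ℝ := fun θ => fderiv ℝ (fderiv ℝ Φ) (x + θ • ξ) ξ ξ with hg''
  have hg1 : ∀ θ ∈ Icc (0 : ℝ) 1, HasDerivAt g (g' θ) θ := fun θ hθ =>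
    hasDerivAt_comp_lineSegment_of_contDiffOn hU hΦ x ξ (hseg θ hθ)
  have hg2 : ∀ θ ∈ Icc (0 : ℝ) 1, HasDerivAt g' (g'' θ) θ := fun θ hθ =>
    hasDerivAt_fderiv_comp_lineSegment_of_contDiffOn hU hΦ x ξ (hseg θ hθ)
  have hg2low : ∀ θ ∈ Icc (0 : ℝ) 1, 2 * q ≤ g'' θ := fun θ hθ => by
    have := hH θ hθ
    rwa [iteratedFDeriv_two_apply] at this
  set φ : ℝ → ℝ := fun θ => g θ - g 0 - θ * g' 0 - θ ^ 2 * q with hφ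
  set φ' : ℝ → ℝ := fun θ => g' θ - g' 0 - 2 * θ * q with hφ'
  have hφd : ∀ θ ∈ Icc (0 : ℝ) 1, HasDerivAt φ (φ' θ) θ := fun θ hθ => by
    have h2 : HasDerivAt (fun θ' : ℝ => θ' * g' 0) (g' 0) θ := by
      simpa using (hasDerivAt_id θ).mul_const (g' 0)
    have h3 : HasDerivAt (fun θ' : ℝ => θ' ^ 2 * q) (2 * θ * q) θ := by
      have := (hasDerivAt_pow 2 θ).mul_const q
      refine this.congr_deriv ?_
      simp only [Nat.cast_ofNat, Nat.add_one_sub_one, pow_one]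
    exact ((((hg1 θ hθ).sub_const (g 0)).sub h2).sub h3).congr_deriv (by simp [hφ'])
  have hφ'd : ∀ θ ∈ Icc (0 : ℝ) 1, HasDerivAt φ' (g'' θ - 2 * q) θ := fun θ hθ => by
    have h3 : HasDerivAt (fun θ' : ℝ => 2 * θ' * q) (2 * q) θ := by
      simpa using ((hasDerivAt_id θ).const_mul (2 : ℝ)).mul_const q
    exact ((hg2 θ hθ).sub_const (g' 0)).sub h3
  have hIoo : ∀ θ ∈ interior (Icc (0 : ℝ) 1), θ ∈ Icc (0 : ℝ) 1 := fun θ hθ => interior_subset hθ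
  have hφ'mono : MonotoneOn φ' (Icc 0 1) := by
    refine monotoneOn_of_deriv_nonneg (convex_Icc 0 1)
      (fun θ hθ => (hφ'd θ hθ).continuousAt.continuousWithinAt)
      (fun θ hθ => (hφ'd θ (hIoo θ hθ)).differentiableAt.differentiableWithinAt) fun θ hθ => ?_
    have hθ' := hIoo θ hθ
    rw [(hφ'd θ hθ').deriv]
    linarith [hg2low θ hθ']
  have hφ'nonneg : ∀ θ ∈ Icc (0 : ℝ) 1, 0 ≤ φ' θ := fun θ hθ => by
    have h0 : φ' 0 = 0 := by simp [hφ']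
    rw [← h0]
    exact hφ'mono (left_mem_Icc.2 zero_le_one) hθ hθ.1
  have hφmono : MonotoneOn φ (Icc 0 1) := by
    refine monotoneOn_of_deriv_nonneg (convex_Icc 0 1)
      (fun θ hθ => (hφd θ hθ).continuousAt.continuousWithinAt)
      (fun θ hθ => (hφd θ (hIoo θ hθ)).differentiableAt.differentiableWithinAt) fun θ hθ => ?_
    have hθ' := hIoo θ hθ
    rw [(hφd θ hθ').deriv]
    exact hφ'nonneg θ hθ'
  have hφ1 : 0 ≤ φ 1 := by
    have h0 : φ 0 = 0 := by simp [hφ]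
    rw [← h0]
    exact hφmono (left_mem_Icc.2 zero_le_one) (right_mem_Icc.2 zero_le_one) zero_le_one
  simp only [hφ, hg, hg', one_smul, zero_smul, add_zero, one_mul, one_pow] at hφ1
  have hy' : x + ξ = y := by rw [hξ]; abel
  rw [hy'] at hφ1
  linarith

/-- **HESSIAN ENTRY FOR A WINDOW-SMOOTH EXPONENT** (`fderiv` currency): `U` open, `K ⊆ U` convex, `Φ ∈ C²(U)`,
`∀ x ∈ K, ∀ v, 2·Q(v) ≤ D²Φ(x)[v, v]` ⟹ `∀ x y ∈ K, Φ x + DΦ(x)(y − x) + Q(y − x) ≤ Φ y` — the exponent may be undefined ∕ rough off `U`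
(print's exponents live on their analyticity domains). [folklore] -/
theorem firstOrderOn_form_of_hessianOn_lower_fderiv_of_contDiffOn {Φ : E → ℝ} {U K : Set E} (hU : IsOpen U) (hKU : K ⊆ U)
    (hK : Convex ℝ K) (hΦ : ContDiffOn ℝ 2 Φ U) (Q : E → ℝ) (hH : ∀ x ∈ K, ∀ v : E, 2 * Q v ≤ iteratedFDeriv ℝ 2 Φ x ![v, v]) :
    ∀ x ∈ K, ∀ y ∈ K, Φ x + fderiv ℝ Φ x (y - x) + Q (y - x) ≤ Φ y := by
  intro x hx y hy
  have hseg : ∀ θ ∈ Icc (0 : ℝ) 1, x + θ • (y - x) ∈ K := fun θ hθ =>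
    hK.add_smul_mem hx (by rw [add_sub_cancel]; exact hy) hθ
  exact apply_add_fderiv_add_le_of_segment_of_contDiffOn hU hΦ x y (fun θ hθ => hKU (hseg θ hθ))
    (fun θ hθ => hH _ (hseg θ hθ) _)

/-- The display may be given WITHIN `U` (`iteratedFDerivWithin`, the natural currency for a function known only on `U`): on an open `U` it
is the same display (Mathlib `iteratedFDerivWithin_of_isOpen`). [folklore] -/
theorem firstOrderOn_form_of_hessianWithin_lower_fderiv {Φ : E → ℝ} {U K : Set E} (hU : IsOpen U) (hKU : K ⊆ U)
    (hK : Convex ℝ K) (hΦ : ContDiffOn ℝ 2 Φ U) (Q : E → ℝ)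
    (hH : ∀ x ∈ K, ∀ v : E, 2 * Q v ≤ iteratedFDerivWithin ℝ 2 Φ U x ![v, v]) :
    ∀ x ∈ K, ∀ y ∈ K, Φ x + fderiv ℝ Φ x (y - x) + Q (y - x) ≤ Φ y :=
  firstOrderOn_form_of_hessianOn_lower_fderiv_of_contDiffOn hU hKU hK hΦ Q fun x hx v => by
    rw [← iteratedFDerivWithin_of_isOpen 2 hU (hKU hx)]; exact hH x hx v

/-- The same in gradient currency (complete real inner product space). [folklore] -/
theorem firstOrderOn_form_of_hessianOn_lower_of_contDiffOn {F : Type*} [NormedAddCommGroup F] [InnerProductSpace ℝ F] [CompleteSpace F]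
    {Φ : F → ℝ} {U K : Set F} (hU : IsOpen U) (hKU : K ⊆ U) (hK : Convex ℝ K) (hΦ : ContDiffOn ℝ 2 Φ U) (Q : F → ℝ)
    (hH : ∀ x ∈ K, ∀ v : F, 2 * Q v ≤ iteratedFDeriv ℝ 2 Φ x ![v, v]) :
    ∀ x ∈ K, ∀ y ∈ K, Φ x + ⟪gradient Φ x, y - x⟫ + Q (y - x) ≤ Φ y := by
  intro x hx y hy
  rw [inner_gradient_left]
  exact firstOrderOn_form_of_hessianOn_lower_fderiv_of_contDiffOn hU hKU hK hΦ Q hH x hx y hy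

end Within

/-! ## Toy check (kernel): the letter is not vacuous -/

/-- Toy: `Φ(t) = t²` on `ℝ` has `D²Φ[v, v] = 2v²`, so with `Q(v) = v²` the letter reads `x² + 2x(y − x) + (y − x)² ≤ y²` — an equality. -/
example (x y : ℝ) : x ^ 2 + 2 * x * (y - x) + (y - x) ^ 2 ≤ y ^ 2 := by nlinarith

end Summit.QuantumFields.BalabanUV.T4Continuum.NE7b.HessianFormFirstOrder
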